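import Summits.QuantumFields.BalabanUV.Beta.EriceRemainderEnclosureHistoryAutonomyComparisonAgeCompositionBVStability
import Summits.QuantumFields.BalabanUV.Beta.EriceRemainderEnclosureHistoryAutonomyComparisonAgeCompositionThreeAgesMassCap

/-!
# EriceRemainderEnclosureHistoryAutonomyComparisonAgeCompositionBVStabilityFlow — (E115b) route (N), first order: THE YOUNG AGE'S SURPLUS ON ANY
# NON-NEGATIVE EXCESS, ALONG EVERY ADMISSIBLE FLOW — THE KEY-FREE COMPOSITION STEP.  (E115a) `sol_ge_local` instantiated for the undamped lone kernel of an
# age `y` (`KL y n l = [0<y<K, l<y]·L_yh_{n+y}³∕2`, row mass `x̃_y(n) = y·L_yh_{n+y}³∕2 ≤ √2∕2` by (E89b) `window_load_le_sqrt_two_div_two`): for EVERY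
# non-negative zero-tailed input `f` (in the induction over the ages: the surplus `S_O e` left by the older ages), every pin `n`, every number `D` of windows,
#     `S_y f n ≥ (1 − x̃_y(n))·f n − x̃_y(n)·Σ_{n≤J<n+Dy} max (f (J+1) − f J) 0 − (√2∕2)^D·(f (n+Dy) + Σ_{J≥n+Dy} |f J − f (J+1)|)`
# (**`flow_young_surplus_ge_local`**), hence the CRITERION **`flow_young_surplus_nonneg_of_slow_increase`**: if the excess increases by at most `η·f n` over
# the `D` young windows below `n` and its far field is at most `M·f n`, then `S_y f n ≥ 0` as soon as `(1 − x̃) − x̃·η − (√2∕2)^D·M ≥ 0` — NO supersolution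
# (KEY) hypothesis, NO monotonicity of `f`.  Numerics of record (kit `g96law` j343456 ∕ `g96law2` j343459, README `HOME/b2b-balaban-beta-d4-p2/g96/README.md`
# §4): with `f = S_O e` (O = the other loaded ages) the bound (local form, §3) is POSITIVE at every pin on every configuration computed — within 8–15 % of the
# true first Neumann term `S_y(S_O e)` at the infrared pin of the row-mass maximisers up to `K = 2^20` (family A: 0.245 vs 0.282; family B: 0.344 vs 0.375;
# `D` = 9–19 windows) and within 1–10 % on 96 spread towers (6–10 loaded ages, ratios 2–10, `T ≤ 1.04`); the increase of the old surplus over two young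
# windows is ≤ 13 % of it; and the full surplus exceeds the first term by 0.01–1.7 % (the Neumann remainder is small AND positive).

Cell `pub-balaban`, β-function sub-cell, BINDER row D4 «RemainderConst leaves for Bałaban's split» (`HOME/BINDER-OWNERS.md`; owner lineage `b2b-balaban-beta-an4`;
this file by co-owner #2 lineage `b2b-balaban-beta-d4-p2`, generation 96), β-FLOW TEAM duty (1), FREEZE (0) honoured (def-free; imports (E115a) and (E89a)
`…ThreeAgesMassCap`; uses (E115a) `sol_ge_local` ∕ `sol_ge_one_sub_row` ∕ `abs_sol_le_var` ∕ `sol_add` ∕ `sol_ge_floor_sub_increase`, (E71a)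
`sol_nonneg_le_of_antitone`, (E89b) `window_load_le_sqrt_two_div_two`, (E48a) `strictAnti_of_memFlow` BY NAME; the display of `KL` is (E80a)'s with
`g ≡ 1`; nothing restated).

HONEST FRAMING (page 1, verbatim and binding).  *"Discharging BetaPertH makes Bałaban's UV stability UNCONDITIONAL — a real constructive-QFT result; it is
NOT the continuum limit and NOT the Clay problem."*  THIS FILE DISCHARGES NOTHING OF THE KIND.  Elementary real analysis about ABSTRACT functionals on a box
]0,γ]^ℕ with displayed floors, profiles and signs, and the FIRST-ORDER renewal objects of route (N) built from them — hypotheses of a census, not facts; the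
form, signs, ages and moments of Bałaban's (1.22) limit functional are NOT PRINTED ([I] p. 298; GAPS G-t4-U2-1∕-2) and NOT asserted.  Row D4 class
UNCHANGED (critical-path width 0; instance 0∕1; D4 DISCHARGE NO DATE).  HONEST DEPENDENCY: continuum YM on T⁴ ⇐ BetaPertH ∧ nine spine estimates (0/9
proved); BetaPertH ⇐ (D1) ∧ (D4) ∧ CAP+tail; G-an2-4 gates asym, D1 and NE2/3/4.

NOT CLAIMED: the smallness of the increase term for the old surplus along flows (README §3: a regularity statement about OLD systems, open); the bound on
the Neumann remainder `ε − S_y(S_O e)`; the END beyond the tree's classes; anything printed — NOT B12 Thm 2, NOT BetaPertH, NOT continuum, NOT Clay.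

WHAT IS PROVED ([folklore]; 0 `def`, 0 sorry).  §0 (abstract complements to (E115a), same conventions) **`abs_sol_le_pow_of_gap'`**, **`sol_ge_local'`**
(locality and the robust local END with the row bound only BELOW the pin).  §1 `young_kernel_facts` (sign, support, row mass `≤ x̃_y(n) ≤ √2∕2`).  §2
`young_indicator_sol_bounds` (`1 − x̃_y(n) ≤ S_y 1_{[0,J]} n ≤ 1`, `≥ 0`).  §3 **`flow_young_surplus_ge_local`** (far field `(√2∕2)^D`),
**`flow_young_surplus_ge_local'`** (far field `x̃_y(n)^D`, `h` antitone by `strictAnti_of_memFlow`), **`flow_young_surplus_nonneg_of_slow_increase`**.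
-/
noncomputable section
open Finset

namespace Summit.QuantumFields.BalabanUV.Beta.EriceRemainderEnclosureHistoryAutonomyComparisonAgeCompositionBVStabilityFlow

open Literature.MathematicalPhysics.QuantumFieldTheory.Balaban1983to89
open Literature.MathematicalPhysics.QuantumFieldTheory.Balaban1983to89.T4BetaStationary
open Literature.MathematicalPhysics.QuantumFieldTheory.Balaban1983to89.T4BetaFlowWellPosed
open Summit.QuantumFields.BalabanUV.Beta.EriceRemainderEnclosureHistoryAutonomyComparisonAgeComposition (sol_nonneg_le_of_antitone)
open Summit.QuantumFields.BalabanUV.Beta.EriceRemainderEnclosureHistoryAutonomyComparisonAgeCompositionBVStability (sol_ge_local sol_ge_one_sub_row abs_sol_le_var sol_add sol_ge_floor_sub_increase)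
open Summit.QuantumFields.BalabanUV.Beta.EriceRemainderEnclosureHistoryAutonomyComparisonAgeCompositionThreeAgesMassCap
  (window_load_le_sqrt_two_div_two)
open Summit.QuantumFields.BalabanUV.Beta.EriceRemainderEnclosureHistoryAutonomyOrder (strictAnti_of_memFlow)

section Abstract
variable {N : ℕ} {K : ℕ → ℕ → ℝ} {R S : (ℕ → ℝ) → ℕ → ℝ}
open Summit.QuantumFields.BalabanUV.Beta.EriceRemainderEnclosureHistoryAutonomyComparisonAgeCompositionBVStability

/-! ## §0 Abstract complements to (E115a): the row-mass hypothesis only below the pin -/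

/-- **LOCALITY WITH A LOCAL ROW BOUND**  As (E115a) `abs_sol_le_pow_of_gap`, but the row sums need to be `≤ ρ ≤ 1` only at the depths `≥ a` (along a flow the
young row mass decreases with the depth, so `ρ` = its value AT the pin serves below it). [folklore] -/
theorem abs_sol_le_pow_of_gap' (hR : ∀ v n, R v n = ∑ l ∈ range N, K n l * v (n + 1 + l)) (hK : ∀ n l, 0 ≤ K n l)
    {ρ : ℝ} {a : ℕ} (hrow : ∀ n, a ≤ n → ∑ l ∈ range N, K n l ≤ ρ) (hρ1 : ρ ≤ 1) {k : ℕ} (hk : 1 ≤ k) (hKk : ∀ n l, k ≤ l → K n l = 0)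
    {w t : ℕ → ℝ} {b : ℕ} (hw : ∀ m, a ≤ m → m < b → w m = 0) (hrec : ∀ n, t n = w n - R t n)
    {M : ℝ} (hM : ∀ m, b ≤ m → |t m| ≤ M) : ∀ D m, a ≤ m → m + D * k ≤ b → |t m| ≤ ρ ^ D * M := by
  have hM0 : 0 ≤ M := (abs_nonneg _).trans (hM b le_rfl)
  -- no amplification across the gap (rows ≥ a have mass ≤ 1)
  have h0 : ∀ m, a ≤ m → |t m| ≤ M := by
    suffices h : ∀ d m, b ≤ m + d → a ≤ m → |t m| ≤ M from fun m hm => h b m (by omega) hm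
    intro d
    induction d with
    | zero => intro m hb _; exact hM m (by omega)
    | succ d ih =>
      intro m hb ha
      by_cases hbm : b ≤ m
      · exact hM m hbm
      rw [hrec m, hw m ha (by omega), zero_sub, abs_neg, hR]
      calc |∑ l ∈ range N, K m l * t (m + 1 + l)| ≤ ∑ l ∈ range N, |K m l * t (m + 1 + l)| := abs_sum_le_sum_abs _ _
        _ = ∑ l ∈ range N, K m l * |t (m + 1 + l)| := sum_congr rfl fun l _ => by rw [abs_mul, abs_of_nonneg (hK m l)]
        _ ≤ ∑ l ∈ range N, K m l * M :=
            sum_le_sum fun l _ => mul_le_mul_of_nonneg_left (ih (m + 1 + l) (by omega) (by omega)) (hK m l)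
        _ = (∑ l ∈ range N, K m l) * M := by rw [sum_mul]
        _ ≤ 1 * M := mul_le_mul_of_nonneg_right ((hrow m ha).trans hρ1) hM0
        _ = M := one_mul M
  by_cases hab : b ≤ a
  · -- degenerate gap: only `D = 0` (or `m ≥ b`) can occur with `a ≤ m`, `m + D k ≤ b`
    intro D m ha hb
    have hD : D * k = 0 := by omega
    have hD0 : D = 0 := by
      rcases Nat.mul_eq_zero.mp hD with h | h
      · exact h
      · omega
    subst hD0; rw [pow_zero, one_mul]; exact h0 m ha
  have hρ0 : 0 ≤ ρ := (sum_nonneg fun l _ => hK a l).trans (hrow a le_rfl)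
  intro D
  induction D with
  | zero => intro m ha _; rw [pow_zero, one_mul]; exact h0 m ha
  | succ D ih =>
    intro m ha hb
    have hsm : (D + 1) * k = D * k + k := Nat.succ_mul D k
    have hmb : m < b := by omega
    rw [hrec m, hw m ha hmb, zero_sub, abs_neg, hR]
    calc |∑ l ∈ range N, K m l * t (m + 1 + l)| ≤ ∑ l ∈ range N, |K m l * t (m + 1 + l)| := abs_sum_le_sum_abs _ _
      _ = ∑ l ∈ range N, K m l * |t (m + 1 + l)| := sum_congr rfl fun l _ => by rw [abs_mul, abs_of_nonneg (hK m l)]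
      _ ≤ ∑ l ∈ range N, K m l * (ρ ^ D * M) := sum_le_sum fun l _ => by
          by_cases hl : k ≤ l
          · rw [hKk m l hl, zero_mul, zero_mul]
          · exact mul_le_mul_of_nonneg_left (ih (m + 1 + l) (by omega) (by omega)) (hK m l)
      _ = (∑ l ∈ range N, K m l) * (ρ ^ D * M) := by rw [sum_mul]
      _ ≤ ρ * (ρ ^ D * M) := mul_le_mul_of_nonneg_right (hrow m ha) (by positivity)
      _ = ρ ^ (D + 1) * M := by rw [pow_succ]; ring

/-- **THE ROBUST LOCAL END WITH A LOCAL ROW BOUND**  As (E115a) `sol_ge_local`, but the far-field factor `ρ` only needs to bound the young row sums at the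
depths `≥ n` — along a flow, `ρ = x̃_y(n)` (the young load AT the pin) instead of the uniform `√2∕2`. [folklore] -/
theorem sol_ge_local' (hR : ∀ v n, R v n = ∑ l ∈ range N, K n l * v (n + 1 + l))
    (hS : ∀ w : ℕ → ℝ, (∀ n, N < n → w n = 0) → (∀ n, N < n → S w n = 0) ∧ ∀ n, S w n = w n - R (S w) n)
    (hK : ∀ n l, 0 ≤ K n l) {n : ℕ} {ρ : ℝ} (hrow : ∀ m, n ≤ m → ∑ l ∈ range N, K m l ≤ ρ) (hρ1 : ρ ≤ 1) {k : ℕ} (hk : 1 ≤ k)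
    (hKk : ∀ n l, k ≤ l → K n l = 0)
    (hEND : ∀ J n, J ≤ N → 0 ≤ S (fun m => if m ≤ J then (1 : ℝ) else 0) n ∧ S (fun m => if m ≤ J then (1 : ℝ) else 0) n ≤ 1)
    {f : ℕ → ℝ} (hf : ∀ n, N < n → f n = 0) (hf0 : ∀ n, 0 ≤ f n) {D : ℕ} {u : ℝ} (hu0 : 0 ≤ u) (hu1 : u ≤ 1)
    (hu : ∀ J, n ≤ J → J ≤ N → u ≤ S (fun m => if m ≤ J then (1 : ℝ) else 0) n) :
    u * f n - (1 - u) * ∑ J ∈ Ico n (n + D * k), max (f (J + 1) - f J) 0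
      - ρ ^ D * (f (n + D * k) + ∑ J ∈ Ico (n + D * k) (N + 1), |f J - f (J + 1)|) ≤ S f n := by
  have hVar0 : ∀ a, 0 ≤ ∑ J ∈ Ico a (N + 1), |f J - f (J + 1)| := fun a => sum_nonneg fun _ _ => abs_nonneg _
  have h1u : 0 ≤ 1 - u := by linarith
  by_cases hD : D = 0
  · subst hD
    simp only [zero_mul, add_zero, Ico_self, sum_empty, mul_zero, sub_zero, pow_zero, one_mul]
    have h := sol_ge_floor_sub_increase hR hS hEND hf (n := n) (u := u) hu
    have hInc0 : 0 ≤ ∑ J ∈ Ico n (N + 1), max (f (J + 1) - f J) 0 := sum_nonneg fun _ _ => le_max_right _ _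
    have hInc : ∑ J ∈ Ico n (N + 1), max (f (J + 1) - f J) 0 ≤ ∑ J ∈ Ico n (N + 1), |f J - f (J + 1)| :=
      sum_le_sum fun J _ => max_le (by rw [abs_sub_comm]; exact le_abs_self _) (abs_nonneg _)
    have hprod : (1 - u) * ∑ J ∈ Ico n (N + 1), max (f (J + 1) - f J) 0 ≤ 1 * ∑ J ∈ Ico n (N + 1), max (f (J + 1) - f J) 0 :=
      mul_le_mul_of_nonneg_right (by linarith) hInc0
    linarith [hf0 n]
  · set b := n + D * k with hb
    have hDk : 0 < D * k := Nat.mul_pos (Nat.pos_of_ne_zero hD) (by omega)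
    have hnb : n < b := by omega
    set f₁ : ℕ → ℝ := fun m => if m < b then f m else 0 with hf₁
    set f₂ : ℕ → ℝ := fun m => if m < b then 0 else f m with hf₂
    have hf₁t : ∀ m, N < m → f₁ m = 0 := fun m hm => by simp only [hf₁, hf m hm, ite_self]
    have hf₂t : ∀ m, N < m → f₂ m = 0 := fun m hm => by simp only [hf₂, hf m hm, ite_self]
    have hsplit : S f n = S f₁ n + S f₂ n := by
      rw [← sol_add hR hS hf₁t hf₂t]
      exact congrArg (fun g => S g n) (funext fun m => by simp only [hf₁, hf₂]; split_ifs <;> simp)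
    have hnear := sol_ge_floor_sub_increase hR hS hEND hf₁t (n := n) (u := u) hu
    have hf₁n : f₁ n = f n := by simp only [hf₁, if_pos hnb]
    have hpt : ∀ J, max (f₁ (J + 1) - f₁ J) 0 ≤ if J < b then max (f (J + 1) - f J) 0 else 0 := fun J => by
      by_cases hJ1 : J + 1 < b
      · simp only [hf₁, if_pos hJ1, if_pos (show J < b by omega)]; exact le_rfl
      · by_cases hJ : J < b
        · simp only [hf₁, if_neg hJ1, if_pos hJ, zero_sub]
          exact max_le ((neg_nonpos.mpr (hf0 J)).trans (le_max_right _ _)) (le_max_right _ _)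
        · simp only [hf₁, if_neg hJ1, if_neg hJ, sub_self, max_self]; exact le_rfl
    have hInc : ∑ J ∈ Ico n (N + 1), max (f₁ (J + 1) - f₁ J) 0 ≤ ∑ J ∈ Ico n b, max (f (J + 1) - f J) 0 :=
      calc ∑ J ∈ Ico n (N + 1), max (f₁ (J + 1) - f₁ J) 0
          ≤ ∑ J ∈ Ico n (N + 1), (if J < b then max (f (J + 1) - f J) 0 else 0) := sum_le_sum fun J _ => hpt J
        _ = ∑ J ∈ (Ico n (N + 1)).filter (· < b), max (f (J + 1) - f J) 0 := (sum_filter _ _).symm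
        _ ≤ ∑ J ∈ Ico n b, max (f (J + 1) - f J) 0 :=
            sum_le_sum_of_subset_of_nonneg (fun J hJ => by
              rw [mem_filter, mem_Ico] at hJ; rw [mem_Ico]; exact ⟨hJ.1.1, hJ.2⟩) (fun _ _ _ => le_max_right _ _)
    have hM : ∀ m, b ≤ m → |S f₂ m| ≤ f b + ∑ J ∈ Ico b (N + 1), |f J - f (J + 1)| := fun m hm => by
      refine (abs_sol_le_var hR hS hEND hf₂t m).trans ?_
      have heq : ∀ J ∈ Ico m (N + 1), |f₂ J - f₂ (J + 1)| = |f J - f (J + 1)| := fun J hJ => by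
        have := (mem_Ico.mp hJ).1
        simp only [hf₂, if_neg (show ¬ J < b by omega), if_neg (show ¬ J + 1 < b by omega)]
      rw [sum_congr rfl heq]
      have hsub : ∑ J ∈ Ico m (N + 1), |f J - f (J + 1)| ≤ ∑ J ∈ Ico b (N + 1), |f J - f (J + 1)| :=
        sum_le_sum_of_subset_of_nonneg (Ico_subset_Ico hm le_rfl) fun _ _ _ => abs_nonneg _
      linarith [hf0 b]
    have hw2 : ∀ m, n ≤ m → m < b → f₂ m = 0 := fun m _ hm => by simp only [hf₂, if_pos hm]
    have hfar := abs_sol_le_pow_of_gap' hR hK hrow hρ1 hk hKk hw2 (hS f₂ hf₂t).2 hM D n le_rfl le_rfl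
    have hfar' := (abs_le.mp hfar).1
    rw [hsplit]
    rw [hf₁n] at hnear
    have hprod := mul_le_mul_of_nonneg_left hInc h1u
    linarith

end Abstract

variable {B : (ℕ → ℝ) → ℝ} {γ b gIR : ℝ} {L : ℕ → ℝ} {K : ℕ} {h : ℕ → ℝ}

/-! ## §1 The undamped lone kernel of the young age: sign, support, row mass -/

/-- **THE YOUNG KERNEL'S FACTS.**  Along an admissible flow the undamped lone kernel `KL y n l = [0<y<K, l<y]·L_yh_{n+y}³∕2` of an age `1 ≤ y < K` is
non-negative, vanishes at the lags `l ≥ y`, and its row sums over any horizon are at most the window load `x̃_y(n) = y·L_yh_{n+y}³∕2 ≤ √2∕2`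
((E89b) `window_load_le_sqrt_two_div_two`). [folklore] -/
theorem young_kernel_facts (hmono : ∀ u v : ℕ → ℝ, SeqBox γ u → SeqBox γ v → (∀ j, u j ≤ v j) → B u ≤ B v)
    (hL : ∀ k, 0 ≤ L k) (hb : 0 < b) (hlo : ∀ u, SeqBox γ u → b ≤ B u) (hdom : ∀ u, SeqBox γ u → ∑ k ∈ range K, L k * u k ≤ B u)
    (hh : SeqBox γ h) (hf : MemFlow B gIR h) {y : ℕ} (hy : 1 ≤ y) (hyK : y < K)
    {KL : ℕ → ℕ → ℕ → ℝ} (hKL : ∀ k n l, KL k n l = if 0 < k ∧ k < K ∧ l < k then L k * h (n + k) ^ 3 / 2 else 0) (N : ℕ) :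
    (∀ n l, 0 ≤ KL y n l) ∧ (∀ n l, y ≤ l → KL y n l = 0) ∧
    (∀ n, ∑ l ∈ range N, KL y n l ≤ (y : ℝ) * (L y * h (n + y) ^ 3 / 2)) ∧ (∀ n, (y : ℝ) * (L y * h (n + y) ^ 3 / 2) ≤ Real.sqrt 2 / 2) := by
  have hpos : ∀ n, 0 < h n := fun n => (hh n).1
  have hw0 : ∀ n, 0 ≤ L y * h (n + y) ^ 3 / 2 := fun n => by have := hL y; have := hpos (n + y); positivity
  refine ⟨fun n l => ?_, fun n l hl => ?_, fun n => ?_, fun n => window_load_le_sqrt_two_div_two hmono hL hb hlo hdom hh hf hyK n⟩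
  · rw [hKL]; split_ifs; · exact hw0 n
    · exact le_rfl
  · rw [hKL, if_neg (by omega)]
  · have hterm : ∀ l ∈ range N, KL y n l = if l < y then L y * h (n + y) ^ 3 / 2 else 0 := by
      intro l _
      rw [hKL]
      by_cases hl : l < y
      · rw [if_pos ⟨by omega, hyK, hl⟩, if_pos hl]
      · rw [if_neg (by omega), if_neg hl]
    calc ∑ l ∈ range N, KL y n l = ∑ l ∈ range N, (if l < y then L y * h (n + y) ^ 3 / 2 else 0) := sum_congr rfl hterm
      _ = ∑ l ∈ (range N).filter (· < y), L y * h (n + y) ^ 3 / 2 := by rw [sum_filter]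
      _ = ((range N).filter (· < y)).card * (L y * h (n + y) ^ 3 / 2) := by rw [sum_const, nsmul_eq_mul]
      _ ≤ (y : ℝ) * (L y * h (n + y) ^ 3 / 2) := by
          refine mul_le_mul_of_nonneg_right ?_ (hw0 n)
          have : ((range N).filter (· < y)).card ≤ y := by
            calc ((range N).filter (· < y)).card ≤ (range y).card :=
                  card_le_card fun l hl => by rw [mem_filter] at hl; exact mem_range.mpr hl.2
              _ = y := card_range y
          exact_mod_cast this

/-! ## §2 The young indicator solutions: in `[0,1]`, and at least `1 − x̃_y` at their own depths -/

/-- **THE YOUNG END WITH ITS FLOOR.**  For the lone young kernel (reads `Ry`, zero-tailed solution operator `Sy` on the horizon `N`): every indicator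
solution satisfies `0 ≤ Sy 1_{[0,J]} n ≤ 1`, and `1 − x̃_y(n) ≤ Sy 1_{[0,J]} n` for `n ≤ J` ((E71a) lone age; (E115a) §4). [folklore] -/
theorem young_indicator_sol_bounds (hmono : ∀ u v : ℕ → ℝ, SeqBox γ u → SeqBox γ v → (∀ j, u j ≤ v j) → B u ≤ B v)
    (hL : ∀ k, 0 ≤ L k) (hb : 0 < b) (hlo : ∀ u, SeqBox γ u → b ≤ B u) (hdom : ∀ u, SeqBox γ u → ∑ k ∈ range K, L k * u k ≤ B u)
    (hh : SeqBox γ h) (hf : MemFlow B gIR h) {y : ℕ} (hy : 1 ≤ y) (hyK : y < K)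
    {KL : ℕ → ℕ → ℕ → ℝ} (hKL : ∀ k n l, KL k n l = if 0 < k ∧ k < K ∧ l < k then L k * h (n + k) ^ 3 / 2 else 0)
    {N : ℕ} {Ry Sy : (ℕ → ℝ) → ℕ → ℝ} (hRy : ∀ v n, Ry v n = ∑ l ∈ range N, KL y n l * v (n + 1 + l))
    (hSy : ∀ w : ℕ → ℝ, (∀ n, N < n → w n = 0) → (∀ n, N < n → Sy w n = 0) ∧ ∀ n, Sy w n = w n - Ry (Sy w) n)
    {J : ℕ} (hJ : J ≤ N) (n : ℕ) :
    0 ≤ Sy (fun m => if m ≤ J then (1 : ℝ) else 0) n ∧ Sy (fun m => if m ≤ J then (1 : ℝ) else 0) n ≤ 1 ∧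
    (n ≤ J → 1 - (y : ℝ) * (L y * h (n + y) ^ 3 / 2) ≤ Sy (fun m => if m ≤ J then (1 : ℝ) else 0) n) := by
  obtain ⟨hK0, -, hrow, hcap⟩ := young_kernel_facts hmono hL hb hlo hdom hh hf hy hyK hKL N
  have hs2 : Real.sqrt 2 / 2 ≤ 1 := by
    have : Real.sqrt 2 ≤ 2 := by
      rw [show (2 : ℝ) = Real.sqrt (2 ^ 2) by rw [Real.sqrt_sq (by norm_num)]]
      exact Real.sqrt_le_sqrt (by norm_num)
    linarith
  have hrow1 : ∀ m, ∑ l ∈ range N, KL y m l ≤ 1 := fun m => ((hrow m).trans (hcap m)).trans hs2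
  have hind_t : ∀ m, N < m → (fun m => if m ≤ J then (1 : ℝ) else 0) m = 0 := fun m hm => if_neg (show ¬ m ≤ J by omega)
  have hind0 : ∀ m, 0 ≤ (fun m => if m ≤ J then (1 : ℝ) else 0) m := fun m => by
    show (0 : ℝ) ≤ (if m ≤ J then (1 : ℝ) else 0); split_ifs <;> norm_num
  have hinda : ∀ m, (fun m => if m ≤ J then (1 : ℝ) else 0) (m + 1) ≤ (fun m => if m ≤ J then (1 : ℝ) else 0) m := fun m => by
    show (if m + 1 ≤ J then (1 : ℝ) else 0) ≤ (if m ≤ J then (1 : ℝ) else 0)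
    by_cases h1 : m + 1 ≤ J
    · rw [if_pos h1, if_pos (by omega)]
    · rw [if_neg h1]; split_ifs <;> norm_num
  have h01 := sol_nonneg_le_of_antitone hRy hK0 hrow1 hind0 hinda (hSy _ hind_t).1 (hSy _ hind_t).2 n
  refine ⟨h01.1, h01.2.trans (by show (if n ≤ J then (1 : ℝ) else 0) ≤ 1; split_ifs <;> norm_num), fun hnJ => ?_⟩
  have hfl := sol_ge_one_sub_row hRy hK0 (ρ := fun m => (y : ℝ) * (L y * h (m + y) ^ 3 / 2)) hrow (fun m => (hcap m).trans hs2)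
    hind0 hinda (hSy _ hind_t).1 (hSy _ hind_t).2 n
  simp only [if_pos hnJ, mul_one] at hfl
  exact hfl

/-! ## §3 The young surplus on any non-negative excess: floor, local increase, far field -/

/-- **THE YOUNG AGE'S SURPLUS ON ANY NON-NEGATIVE EXCESS (every admissible flow, every pin, every horizon, undamped).**  `B` an isotone memory with
floor `b > 0` dominating `L ≥ 0` on the ages `< K`; `h` a box solution; `1 ≤ y < K`; `KL y` the undamped lone kernel of the age `y` with reads `Ry` and
zero-tailed solution operator `Sy` on the horizon `N`; `f ≥ 0` vanishing beyond `N`; `x̃ = y·L_yh_{n+y}³∕2` the young window load at the pin `n`; `D`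
windows, `b = n + D·y`.  THEN
`Sy f n ≥ (1 − x̃)·f n − x̃·Σ_{n≤J<b} max (f (J+1) − f J) 0 − (√2∕2)^D·(f b + Σ_{b≤J≤N} |f J − f (J+1)|)`. [folklore] -/
theorem flow_young_surplus_ge_local (hmono : ∀ u v : ℕ → ℝ, SeqBox γ u → SeqBox γ v → (∀ j, u j ≤ v j) → B u ≤ B v)
    (hL : ∀ k, 0 ≤ L k) (hb : 0 < b) (hlo : ∀ u, SeqBox γ u → b ≤ B u) (hdom : ∀ u, SeqBox γ u → ∑ k ∈ range K, L k * u k ≤ B u)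
    (hh : SeqBox γ h) (hf : MemFlow B gIR h) {y : ℕ} (hy : 1 ≤ y) (hyK : y < K)
    {KL : ℕ → ℕ → ℕ → ℝ} (hKL : ∀ k n l, KL k n l = if 0 < k ∧ k < K ∧ l < k then L k * h (n + k) ^ 3 / 2 else 0)
    {N : ℕ} {Ry Sy : (ℕ → ℝ) → ℕ → ℝ} (hRy : ∀ v n, Ry v n = ∑ l ∈ range N, KL y n l * v (n + 1 + l))
    (hSy : ∀ w : ℕ → ℝ, (∀ n, N < n → w n = 0) → (∀ n, N < n → Sy w n = 0) ∧ ∀ n, Sy w n = w n - Ry (Sy w) n)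
    {f : ℕ → ℝ} (hft : ∀ n, N < n → f n = 0) (hf0 : ∀ n, 0 ≤ f n) (n D : ℕ) :
    (1 - (y : ℝ) * (L y * h (n + y) ^ 3 / 2)) * f n - (y : ℝ) * (L y * h (n + y) ^ 3 / 2) * ∑ J ∈ Ico n (n + D * y), max (f (J + 1) - f J) 0
      - (Real.sqrt 2 / 2) ^ D * (f (n + D * y) + ∑ J ∈ Ico (n + D * y) (N + 1), |f J - f (J + 1)|) ≤ Sy f n := by
  obtain ⟨hK0, hsupp, hrow, hcap⟩ := young_kernel_facts hmono hL hb hlo hdom hh hf hy hyK hKL N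
  have hs2 : Real.sqrt 2 / 2 ≤ 1 := by
    have : Real.sqrt 2 ≤ 2 := by
      rw [show (2 : ℝ) = Real.sqrt (2 ^ 2) by rw [Real.sqrt_sq (by norm_num)]]
      exact Real.sqrt_le_sqrt (by norm_num)
    linarith
  have hEND : ∀ J m, J ≤ N → 0 ≤ Sy (fun m => if m ≤ J then (1 : ℝ) else 0) m ∧ Sy (fun m => if m ≤ J then (1 : ℝ) else 0) m ≤ 1 :=
    fun J m hJ => let h3 := young_indicator_sol_bounds hmono hL hb hlo hdom hh hf hy hyK hKL hRy hSy hJ m; ⟨h3.1, h3.2.1⟩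
  have hx0 : 0 ≤ (y : ℝ) * (L y * h (n + y) ^ 3 / 2) := by
    have := hL y; have := (hh (n + y)).1; positivity
  have hmain := sol_ge_local hRy hSy hK0 (ρ := Real.sqrt 2 / 2) (fun m => (hrow m).trans (hcap m)) hs2 hy (hsupp) hEND hft hf0
    (n := n) (D := D) (u := 1 - (y : ℝ) * (L y * h (n + y) ^ 3 / 2)) (by linarith [hcap n]) (by linarith)
    (fun J hnJ hJN => (young_indicator_sol_bounds hmono hL hb hlo hdom hh hf hy hyK hKL hRy hSy hJN n).2.2 hnJ)
  have e1 : 1 - (1 - (y : ℝ) * (L y * h (n + y) ^ 3 / 2)) = (y : ℝ) * (L y * h (n + y) ^ 3 / 2) := by ring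
  rw [e1] at hmain
  exact hmain

/-- **THE SAME WITH THE LOCAL FAR-FIELD FACTOR `x̃_y(n)^D`.**  Along the flow the young load decreases with the depth (`h` is antitone), so below the
pin every young row has mass `≤ x̃ = x̃_y(n)` and §0's `sol_ge_local'` gives the far field the factor `x̃^D` instead of `(√2∕2)^D`:
`Sy f n ≥ (1 − x̃)·f n − x̃·Σ_{n≤J<n+Dy} max (f (J+1) − f J) 0 − x̃^D·(f (n+Dy) + Σ_{J≥n+Dy} |f J − f (J+1)|)`. [folklore] -/
theorem flow_young_surplus_ge_local' (hmono : ∀ u v : ℕ → ℝ, SeqBox γ u → SeqBox γ v → (∀ j, u j ≤ v j) → B u ≤ B v)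
    (hL : ∀ k, 0 ≤ L k) (hb : 0 < b) (hlo : ∀ u, SeqBox γ u → b ≤ B u) (hdom : ∀ u, SeqBox γ u → ∑ k ∈ range K, L k * u k ≤ B u)
    (hh : SeqBox γ h) (hf : MemFlow B gIR h) {y : ℕ} (hy : 1 ≤ y) (hyK : y < K)
    {KL : ℕ → ℕ → ℕ → ℝ} (hKL : ∀ k n l, KL k n l = if 0 < k ∧ k < K ∧ l < k then L k * h (n + k) ^ 3 / 2 else 0)
    {N : ℕ} {Ry Sy : (ℕ → ℝ) → ℕ → ℝ} (hRy : ∀ v n, Ry v n = ∑ l ∈ range N, KL y n l * v (n + 1 + l))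
    (hSy : ∀ w : ℕ → ℝ, (∀ n, N < n → w n = 0) → (∀ n, N < n → Sy w n = 0) ∧ ∀ n, Sy w n = w n - Ry (Sy w) n)
    {f : ℕ → ℝ} (hft : ∀ n, N < n → f n = 0) (hf0 : ∀ n, 0 ≤ f n) (n D : ℕ) :
    (1 - (y : ℝ) * (L y * h (n + y) ^ 3 / 2)) * f n - (y : ℝ) * (L y * h (n + y) ^ 3 / 2) * ∑ J ∈ Ico n (n + D * y), max (f (J + 1) - f J) 0
      - ((y : ℝ) * (L y * h (n + y) ^ 3 / 2)) ^ D * (f (n + D * y) + ∑ J ∈ Ico (n + D * y) (N + 1), |f J - f (J + 1)|) ≤ Sy f n := by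
  obtain ⟨hK0, hsupp, hrow, hcap⟩ := young_kernel_facts hmono hL hb hlo hdom hh hf hy hyK hKL N
  have hs2 : Real.sqrt 2 / 2 ≤ 1 := by
    have : Real.sqrt 2 ≤ 2 := by
      rw [show (2 : ℝ) = Real.sqrt (2 ^ 2) by rw [Real.sqrt_sq (by norm_num)]]
      exact Real.sqrt_le_sqrt (by norm_num)
    linarith
  have hanti := (strictAnti_of_memFlow hb hlo hh hf).antitone
  have hEND : ∀ J m, J ≤ N → 0 ≤ Sy (fun m => if m ≤ J then (1 : ℝ) else 0) m ∧ Sy (fun m => if m ≤ J then (1 : ℝ) else 0) m ≤ 1 :=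
    fun J m hJ => let h3 := young_indicator_sol_bounds hmono hL hb hlo hdom hh hf hy hyK hKL hRy hSy hJ m; ⟨h3.1, h3.2.1⟩
  -- below the pin the young rows are lighter than at the pin
  have hrown : ∀ m, n ≤ m → ∑ l ∈ range N, KL y m l ≤ (y : ℝ) * (L y * h (n + y) ^ 3 / 2) := fun m hm => by
    refine (hrow m).trans (mul_le_mul_of_nonneg_left ?_ (Nat.cast_nonneg y))
    have h1 : h (m + y) ≤ h (n + y) := hanti (by omega)
    have h2 : h (m + y) ^ 3 ≤ h (n + y) ^ 3 := pow_le_pow_left₀ (le_of_lt (hh (m + y)).1) h1 3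
    have := hL y
    have : L y * h (m + y) ^ 3 ≤ L y * h (n + y) ^ 3 := mul_le_mul_of_nonneg_left h2 this
    linarith
  have hmain := sol_ge_local' hRy hSy hK0 (ρ := (y : ℝ) * (L y * h (n + y) ^ 3 / 2)) hrown ((hcap n).trans hs2) hy hsupp hEND hft hf0
    (n := n) (D := D) (u := 1 - (y : ℝ) * (L y * h (n + y) ^ 3 / 2)) (by linarith [hcap n]) (by
      have := hL y; have := (hh (n + y)).1; have : 0 ≤ (y : ℝ) * (L y * h (n + y) ^ 3 / 2) := by positivity
      linarith)
    (fun J hnJ hJN => (young_indicator_sol_bounds hmono hL hb hlo hdom hh hf hy hyK hKL hRy hSy hJN n).2.2 hnJ)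
  have e1 : 1 - (1 - (y : ℝ) * (L y * h (n + y) ^ 3 / 2)) = (y : ℝ) * (L y * h (n + y) ^ 3 / 2) := by ring
  rw [e1] at hmain
  exact hmain

/-- **THE KEY-FREE CRITERION.**  In the setting of `flow_young_surplus_ge_local`: if the excess increases by at most `η·f n` over the `D` young windows below
the pin, `Σ_{n≤J<n+Dy} max (f (J+1) − f J) 0 ≤ η·f n`, its far field is at most `M·f n`, `f (n+Dy) + Σ_{J≥n+Dy} |f J − f (J+1)| ≤ M·f n`, and
`x̃·η + (√2∕2)^D·M ≤ 1 − x̃` (`x̃ = y·L_yh_{n+y}³∕2 ≤ √2∕2`), then `0 ≤ Sy f n`.  (For the old surplus `f = S_O e` of an induction over the ages this is the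
composition step WITHOUT the supersolution hypothesis KEY of (E71a).) [folklore] -/
theorem flow_young_surplus_nonneg_of_slow_increase (hmono : ∀ u v : ℕ → ℝ, SeqBox γ u → SeqBox γ v → (∀ j, u j ≤ v j) → B u ≤ B v)
    (hL : ∀ k, 0 ≤ L k) (hb : 0 < b) (hlo : ∀ u, SeqBox γ u → b ≤ B u) (hdom : ∀ u, SeqBox γ u → ∑ k ∈ range K, L k * u k ≤ B u)
    (hh : SeqBox γ h) (hf : MemFlow B gIR h) {y : ℕ} (hy : 1 ≤ y) (hyK : y < K)
    {KL : ℕ → ℕ → ℕ → ℝ} (hKL : ∀ k n l, KL k n l = if 0 < k ∧ k < K ∧ l < k then L k * h (n + k) ^ 3 / 2 else 0)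
    {N : ℕ} {Ry Sy : (ℕ → ℝ) → ℕ → ℝ} (hRy : ∀ v n, Ry v n = ∑ l ∈ range N, KL y n l * v (n + 1 + l))
    (hSy : ∀ w : ℕ → ℝ, (∀ n, N < n → w n = 0) → (∀ n, N < n → Sy w n = 0) ∧ ∀ n, Sy w n = w n - Ry (Sy w) n)
    {f : ℕ → ℝ} (hft : ∀ n, N < n → f n = 0) (hf0 : ∀ n, 0 ≤ f n) (n D : ℕ) {η M : ℝ}
    (hinc : ∑ J ∈ Ico n (n + D * y), max (f (J + 1) - f J) 0 ≤ η * f n)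
    (hfarM : f (n + D * y) + ∑ J ∈ Ico (n + D * y) (N + 1), |f J - f (J + 1)| ≤ M * f n)
    (hcrit : (y : ℝ) * (L y * h (n + y) ^ 3 / 2) * η + (Real.sqrt 2 / 2) ^ D * M ≤ 1 - (y : ℝ) * (L y * h (n + y) ^ 3 / 2)) :
    0 ≤ Sy f n := by
  have hmain := flow_young_surplus_ge_local hmono hL hb hlo hdom hh hf hy hyK hKL hRy hSy hft hf0 n D
  have hx0 : 0 ≤ (y : ℝ) * (L y * h (n + y) ^ 3 / 2) := by
    have := hL y; have := (hh (n + y)).1; positivity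
  have hq0 : 0 ≤ (Real.sqrt 2 / 2) ^ D := by positivity
  have h1 := mul_le_mul_of_nonneg_left hinc hx0
  have h2 := mul_le_mul_of_nonneg_left hfarM hq0
  have h3 := mul_le_mul_of_nonneg_right hcrit (hf0 n)
  nlinarith [h1, h2, h3, hf0 n]

end Summit.QuantumFields.BalabanUV.Beta.EriceRemainderEnclosureHistoryAutonomyComparisonAgeCompositionBVStabilityFlow

end
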